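import Summits.BirchSwinnertonDyer.Rank1Residual.X11b.BDPRouteOpenInputFieldGivenRecord
import Summits.BirchSwinnertonDyer.Rank1Residual.X11b.BDPRouteOpenInputTight
import Summits.BirchSwinnertonDyer.Rank1Residual.X11b.RouteR1RecordsEP
import HarnessLib

/-!
# Class X11b, route p2 at `p ≥ 5` — the CLASSICAL-FIELD END records and the Locus TIGHTNESS with
# the cited input `hEP` DISCHARGED (Tate's local Euler–Poincaré characteristic formula is a kernel
# theorem, `GaloisImage.EPCTate.localEulerPoincareCharacteristic`)
# (cell `b2b-bsdres`, sub-cell `multr1-p2`, gen 31; file 2 of 2)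

HONEST FRAMING (cell `b2b-bsdres`, run/shared/lean/b2b/bsd-rank1-residual/, verbatim in every
file): the goal of the cell is to DELETE the COMBINATION-SHAPED residual classes of the
Birch–Swinnerton-Dyer formula for ALL analytic-rank `≤ 1` elliptic curves over `ℚ` — "full BSD
formula for every rank `≤ 1` curve in class `C`" assembled STRICTLY from published theorems — so
that the rank-`≤ 1` remainder becomes exactly the CONSTRUCTION-SHAPED classes, which are TYPED
(missing-input `Prop`s), NOT attempted. This is not "finishing BSD". Research route `p2` for class
X11b; no claim beyond the stated class and loci; nothing booked; no mark / label / count moved;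
X11b stays CONSTRUCTION-SHAPED. THEOREMS ONLY (no definition, no named fact, no `sorry`); every
statement CONDITIONAL on the named OPEN shape (and the PUB-shaped control identity where said).

## What this file does

The sibling `X11b/BDPRouteRecordsEP.lean` re-issues the erratum-data END records of route p2
without the cited binder `hEP` (Milne, *ADT* I Thm. 2.8 — now the kernel theorem
`GaloisImage.EPCTate.localEulerPoincareCharacteristic` of team n1011's row T-EPC, instantiated at the
completions `K_v` by route R1's `R1.localEulerPoincareCharacteristic_adicCompletion`, REUSED here).
This file does the same for the records over ONE admissible classical Heegner field per pair and
for the TIGHTNESS statements on the Locus; every statement is the statement of record with `hEP`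
deleted and NOTHING ELSE changed, every proof the record of record applied to
`R1.localEulerPoincareCharacteristic_adicCompletion`:

* §1 `P2.bsdp_of_locus_of_openInputAtGivenFieldEP` (any Locus pair from published facts + `hPT` +
  THE open input over ONE admissible field) and the tightness
  `P2.openInputOnTreeAtGivenField_iff_bsdp_of_locusEP`, `P2.openInputOnTreeAt_iff_bsdp_of_locusEP`
  (on the Locus the open input ⟺ `BSD(E,p)`, given the PUB-shaped control identity).
* §2 `P2.bsdp_of_semistable_of_imcDivSomeFrameAtGivenFieldEP` — the SEMISTABLE END STATE over one
  field (753 185 pairs class-wide; nothing on the Locus, one certificate off it).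
* §3 `P2.bsdp_of_onTree_endStateAtGivenFieldEP` — THE END-STATE CLASS RECORD over one field per
  pair (gen 28), `hEP`-free.

After these two files every END record of route p2 carries ONE CITED standard fact (`hPT`,
Poitou–Tate, Milne I Thm. 4.10(b)) + PUBLISHED named facts + the OPEN shapes as before. CONDITIONAL;
deletes nothing; the records of record are untouched (new leaf file); no label change.

References: [Castella2018Erratum] (2.4), Thm. 1.1; [Castella2018] Thms. 2.3, 3.1, 3.2, §5
(arXiv:1704.06608 pp. 5, 9, 12); [MilneADT2006] I §2 Thm. 2.8 (p. 31), I Thm. 4.10(b);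
[SerreGaloisCohomology1997] II §5.7 Thm. 5; [McCallumLMS1991] §1; [Skinner2016PacificMC] Thm. C;
[Disegni2020] Thm. 1, (∗); [Wuthrich2014] Thm. 3, Prop. 21; [SteinWuthrich2013] Thm. 6.1;
[BalakrishnanEtAl2019] Thm. 1.2; [Miller2011LMS] Def. 1.1.
-/

noncomputable section

open scoped Classical NumberField

open WeierstrassCurve NumberField IsDedekindDomain Field
open Literature.NumberTheory.EllipticCurves Literature.NumberTheory.EllipticCurves.GreenbergSelmer
  Literature.NumberTheory.EllipticCurves.ModularForms
  Literature.NumberTheory.EllipticCurves.Rank1Residual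
  Literature.NumberTheory.EllipticCurves.Rank1Residual.Typed
  Literature.NumberTheory.EllipticCurves.Wuthrich2014
  Literature.NumberTheory.EllipticCurves.Castella2018
  Literature.NumberTheory.EllipticCurves.SteinWuthrich2013
  Literature.NumberTheory.EllipticCurves.Disegni2020
  Literature.NumberTheory.EllipticCurves.Skinner2016
  Literature.NumberTheory.EllipticCurves.BalakrishnanEtAl2019
  Literature.NumberTheory.EllipticCurves.KrizLi2019
  Literature.NumberTheory.QuadraticFields.Quadratic
  Literature.NumberTheory.Automorphic
  Literature.NumberTheory.GaloisRepresentations Literature.NumberTheory.GaloisCohomology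

namespace Summit.BirchSwinnertonDyer.Rank1Residual.X11b

section Records

variable (W : WeierstrassCurve ℚ) [W.IsElliptic] [W.IsGloballyMinimal] (p : ℕ) [Fact p.Prime]

/-! ### §1 The Locus over one field, and the tightness of the open input, `hEP`-free -/

/-- **A Locus pair, `BSD(E,p)` from published facts, the ONE cited `hPT`, and THE open input over
ONE admissible field, `hEP` discharged.** Gen 28's `P2.bsdp_of_locus_of_openInputAtGivenField`
(both halves at the GIVEN field) with `hEP` (Milne I Thm. 2.8, now the kernel theorem
`GaloisImage.EPCTate.localEulerPoincareCharacteristic`) supplied by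
`R1.localEulerPoincareCharacteristic_adicCompletion`; nothing else changed. CONDITIONAL on the input
over `K`; nothing booked. [cite: Castella2018Erratum, (2.4), Thm. 1.1 (pp. 1, 4)]
[cite: Castella2018, Thms. 3.1–3.2, §5] [cite: Skinner2016PacificMC, Thm. C (§1)]
[cite: McCallumLMS1991, §1 Theorem (Kolyvagin), p. 296] [cite: MilneADT2006, Ch. I, Thm. 2.8 (p. 31)]
[cite: Miller2011LMS, Def. 1.1] -/
theorem P2.bsdp_of_locus_of_openInputAtGivenFieldEP {K : Type} [Field K] [NumberField K]
    (hGZ : ∀ (N : ℕ) [NeZero N] (W : WeierstrassCurve ℚ) (K : Type) [Field K] [NumberField K],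
      gross_zagier N W K)
    (hKo : ∀ (N : ℕ) [NeZero N] (W : WeierstrassCurve ℚ) (K : Type) [Field K] [NumberField K],
      kolyvagin N W K)
    (hB : ∀ (N : ℕ) [NeZero N] (W : WeierstrassCurve ℚ) (K : Type) [Field K] [NumberField K],
      Kolyvagin1990_padicValNat_card_sha_le N W K)
    (hSk : Skinner2016.thmC_padicValRat_bsd_rank_zero) (hWu : sha_dvd_analyticSha)
    (hGZK : rank_eq_analyticRank_of_analyticRank_le_one) (hmod : hasEntireLFunction_rat)
    (hnf : exists_isNewformOf) (hMaz : mazur_not_dvd_maninConstant_of_odd)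
    (hPT : ∀ (K : Type) [Field K] [NumberField K], poitouTate_sum_localTatePairing_eq_zero K)
    (hK : IsImaginaryQuadratic K) (hodd : Odd (NumberField.discr K))
    (hpd : ¬ (p : ℤ) ∣ NumberField.discr K) (hμ : ¬ p ∣ Units.torsionOrder K)
    (hHN : SatisfiesHeegnerHypothesis (W.conductorNorm ℤ) K)
    (hLt : (W.quadraticTwist (NumberField.discr K : ℚ)).entireLFunction 1 ≠ 0)
    (hA : P2.OpenInputOnTreeAtField W p K)
    (hX : ClassX11b W p) (hp5 : 5 ≤ p) (hram : Ram W p) (htam : ¬ p ∣ W.tamagawaProduct) :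
    BSDp W p :=
  P2.bsdp_of_locus_of_openInputAtGivenField W p hGZ hKo hB hSk hWu hGZK hmod hnf hMaz hPT
    R1.localEulerPoincareCharacteristic_adicCompletion hK hodd hpd hμ hHN hLt hA hX hp5 hram htam

/-- **TIGHTNESS OVER ONE FIELD, `hEP` discharged: on the Locus the open input over ANY admissible
field ⟺ `BSD(E,p)`**, given the published facts, the ONE cited `hPT` and the PUB-shaped control
identity `P2ControlOnTreeAt W p` (Cas18 Thm. 2.3 as an identity; used only in `⟸`). Gen 28's
`P2.openInputOnTreeAtGivenField_iff_bsdp_of_locus` with `hEP` supplied; nothing else changed.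
CONDITIONAL bookkeeping; nothing booked. [cite: Castella2018, Thm. 2.3 (p. 5), Thm. 3.2 (p. 9), §5 (p. 12)]
[cite: Castella2018Erratum, (2.4) (p. 4)] [cite: Skinner2016PacificMC, Thm. C (§1)]
[cite: MilneADT2006, Ch. I, Thm. 2.8 (p. 31)] -/
theorem P2.openInputOnTreeAtGivenField_iff_bsdp_of_locusEP {K : Type} [Field K] [NumberField K]
    (hGZ : ∀ (N : ℕ) [NeZero N] (W : WeierstrassCurve ℚ) (K : Type) [Field K] [NumberField K],
      gross_zagier N W K)
    (hKo : ∀ (N : ℕ) [NeZero N] (W : WeierstrassCurve ℚ) (K : Type) [Field K] [NumberField K],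
      kolyvagin N W K)
    (hB : ∀ (N : ℕ) [NeZero N] (W : WeierstrassCurve ℚ) (K : Type) [Field K] [NumberField K],
      Kolyvagin1990_padicValNat_card_sha_le N W K)
    (hSk : Skinner2016.thmC_padicValRat_bsd_rank_zero) (hWu : sha_dvd_analyticSha)
    (hGZK : rank_eq_analyticRank_of_analyticRank_le_one) (hmod : hasEntireLFunction_rat)
    (hnf : exists_isNewformOf) (hMaz : mazur_not_dvd_maninConstant_of_odd)
    (hPT : ∀ (K : Type) [Field K] [NumberField K], poitouTate_sum_localTatePairing_eq_zero K)
    (hC : P2ControlOnTreeAt W p)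
    (hK : IsImaginaryQuadratic K) (hodd : Odd (NumberField.discr K))
    (hpd : ¬ (p : ℤ) ∣ NumberField.discr K) (hμ : ¬ p ∣ Units.torsionOrder K)
    (hHN : SatisfiesHeegnerHypothesis (W.conductorNorm ℤ) K)
    (hLt : (W.quadraticTwist (NumberField.discr K : ℚ)).entireLFunction 1 ≠ 0)
    (hX : ClassX11b W p) (hp5 : 5 ≤ p) (hram : Ram W p) (htam : ¬ p ∣ W.tamagawaProduct) :
    P2.OpenInputOnTreeAtField W p K ↔ BSDp W p :=
  P2.openInputOnTreeAtGivenField_iff_bsdp_of_locus W p hGZ hKo hB hSk hWu hGZK hmod hnf hMaz hPT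
    R1.localEulerPoincareCharacteristic_adicCompletion hC hK hodd hpd hμ hHN hLt hX hp5 hram htam

/-- **THE OPEN INPUT ⟺ `BSD(E,p)` ON THE LOCUS, `hEP` discharged** (gen 18's
`P2.openInputOnTreeAt_iff_bsdp_of_locus`: `(E,p) ∈` X11b, `p ≥ 5`, a (ram) prime, `p ∤ ∏_ℓ c_ℓ(E)`;
class-wide 2 093 111 pairs), given the published facts of the route, the ONE cited `hPT` and the
PUB-shaped control identity `P2ControlOnTreeAt W p` (used only in `⟸`). `hEP` supplied by
`R1.localEulerPoincareCharacteristic_adicCompletion`; nothing else changed. CONDITIONAL bookkeeping;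
nothing booked; X11b stays CONSTRUCTION-SHAPED.
[cite: Castella2018, Thm. 2.3 (p. 5), Thm. 3.2 (p. 9)] [cite: Castella2018Erratum, (2.4) (p. 1)]
[cite: JetchevSkinnerWan2017, §7.4.1–7.4.3 (pp. 30–31), Thm. 3.3.1] [cite: Skinner2016PacificMC, Thm. C (§1)]
[cite: McCallumLMS1991, §1 Theorem (Kolyvagin), p. 296] [cite: MilneADT2006, Ch. I, Thm. 2.8 (p. 31)]
[cite: Miller2011LMS, Def. 1.1] -/
theorem P2.openInputOnTreeAt_iff_bsdp_of_locusEP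
    (hGZ : ∀ (N : ℕ) [NeZero N] (W : WeierstrassCurve ℚ) (K : Type) [Field K] [NumberField K],
      gross_zagier N W K)
    (hKo : ∀ (N : ℕ) [NeZero N] (W : WeierstrassCurve ℚ) (K : Type) [Field K] [NumberField K],
      kolyvagin N W K)
    (hB : ∀ (N : ℕ) [NeZero N] (W : WeierstrassCurve ℚ) (K : Type) [Field K] [NumberField K],
      Kolyvagin1990_padicValNat_card_sha_le N W K)
    (hSk : Skinner2016.thmC_padicValRat_bsd_rank_zero) (hWu : sha_dvd_analyticSha)
    (hGZK : rank_eq_analyticRank_of_analyticRank_le_one) (hmod : hasEntireLFunction_rat)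
    (hnf : exists_isNewformOf) (hHL : HoffsteinLuo1997_exists_twist_L_one_ne_zero)
    (hMaz : mazur_not_dvd_maninConstant_of_odd)
    (hPT : ∀ (K : Type) [Field K] [NumberField K], poitouTate_sum_localTatePairing_eq_zero K)
    (hC : P2ControlOnTreeAt W p)
    (hX : ClassX11b W p) (hp5 : 5 ≤ p) (hram : Ram W p) (htam : ¬ p ∣ W.tamagawaProduct) :
    P2OpenInputOnTreeAt W p ↔ BSDp W p :=
  P2.openInputOnTreeAt_iff_bsdp_of_locus W p hGZ hKo hB hSk hWu hGZK hmod hnf hHL hMaz hPT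
    R1.localEulerPoincareCharacteristic_adicCompletion hC hX hp5 hram htam

/-! ### §2 The semistable end state over one field, `hEP`-free -/

/-- **SEMISTABLE END STATE OVER ONE FIELD, `hEP` discharged.** Every semistable X11b pair at
`p ≥ 5` (753 185 class-wide): `BSD(E,p)` from route p2's and the lever's published named facts,
`h32` (Cas18 Thms. 3.1–3.2), the ONE cited `hPT`, THE open statement (2.4)∃♭ over ONE admissible
field `K₀` (`P2.IMCDivSomeFrameOnTreeAtField W p K₀`), and — OFF the Locus only — one certificate
(REG, or TC when `p ∤ ∏c`). Gen 28's `P2.bsdp_of_semistable_of_imcDivSomeFrameAtGivenField` with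
`hEP` (Milne I Thm. 2.8, now the kernel theorem `GaloisImage.EPCTate.localEulerPoincareCharacteristic`)
supplied by `R1.localEulerPoincareCharacteristic_adicCompletion`; nothing else changed. CONDITIONAL on
(2.4)∃♭ over `K₀` (OPEN) and the certificate; nothing booked.
[cite: Castella2018Erratum, (2.4), Thm. 1.1 (pp. 1, 4)] [cite: Castella2018, Thms. 2.3, 3.1, 3.2, §5]
[cite: Skinner2016PacificMC, Thm. C (§1)] [cite: McCallumLMS1991, §1 Theorem (Kolyvagin), p. 296]
[cite: Disegni2020, Thm. 1 (§1.2), (∗)] [cite: Wuthrich2014, Thm. 3 (p. 383), Prop. 21 (p. 400)]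
[cite: SteinWuthrich2013, Thm. 6.1, §4.2] [cite: MilneADT2006, Ch. I, Thm. 2.8 (p. 31)]
[cite: Miller2011LMS, Def. 1.1] -/
theorem P2.bsdp_of_semistable_of_imcDivSomeFrameAtGivenFieldEP
    (hGZ : ∀ (N : ℕ) [NeZero N] (W : WeierstrassCurve ℚ) (K : Type) [Field K] [NumberField K],
      gross_zagier N W K)
    (hKo : ∀ (N : ℕ) [NeZero N] (W : WeierstrassCurve ℚ) (K : Type) [Field K] [NumberField K],
      kolyvagin N W K)
    (hB : ∀ (N : ℕ) [NeZero N] (W : WeierstrassCurve ℚ) (K : Type) [Field K] [NumberField K],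
      Kolyvagin1990_padicValNat_card_sha_le N W K)
    (hSk : Skinner2016.thmC_padicValRat_bsd_rank_zero) (hWu : sha_dvd_analyticSha)
    (hGZK : rank_eq_analyticRank_of_analyticRank_le_one) (hnf : exists_isNewformOf)
    (hMaz : mazur_not_dvd_maninConstant_of_odd)
    (hPT : ∀ (K : Type) [Field K] [NumberField K], poitouTate_sum_localTatePairing_eq_zero K)
    (h32 : thm32_exists_isBDPLFunction_valueAtOne)
    (hK : kato_charIdeal_dvd_multiplicative_of_surjective)
    (hJn : thm61_nonsplitMultiplicative) (hJs : thm61_splitMultiplicative)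
    (hHn : exists_isMultCanonical) (hHs : exists_isSplitMultCanonical)
    (hD : thm1_padicBSD_rankOne_multiplicative) (hpar : nonempty_modularParametrizationData)
    (hss : Semistable W) (hX : ClassX11b W p) (hp5 : 5 ≤ p)
    {K₀ : Type} [Field K₀] [NumberField K₀]
    (hK₀ : IsImaginaryQuadratic K₀) (hodd : Odd (NumberField.discr K₀))
    (hpd : ¬ (p : ℤ) ∣ NumberField.discr K₀) (hμ : ¬ p ∣ Units.torsionOrder K₀)
    (hHN₀ : SatisfiesHeegnerHypothesis (W.conductorNorm ℤ) K₀)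
    (hLt₀ : (W.quadraticTwist (NumberField.discr K₀ : ℚ)).entireLFunction 1 ≠ 0)
    (hDiv : P2.IMCDivSomeFrameOnTreeAtField W p K₀)
    (hcert : ¬ (Ram W p ∧ ¬ p ∣ W.tamagawaProduct) →
      ClassClosure.RegulatorNonvanishingAt W p ∨
      (¬ p ∣ W.tamagawaProduct ∧
        ∃ (K : Type) (_ : Field K) (_ : NumberField K) (Wd : WeierstrassCurve ℚ) (_ : Wd.IsElliptic)
          (_ : Wd.IsGloballyMinimal) (Cd : VariableChange ℚ) (qd : ℚ),
          IsImaginaryQuadratic K ∧ SatisfiesHeegnerHypothesis (W.conductorNorm ℤ) K ∧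
          NumberField.discr K < -4 ∧ Cd • W.quadraticTwist (NumberField.discr K : ℚ) = Wd ∧
          Wd.entireLFunction 1 / (Wd.realPeriodRat : ℂ) = (qd : ℂ) ∧ qd ≠ 0 ∧ padicValRat p qd = 0)) :
    BSDp W p :=
  P2.bsdp_of_semistable_of_imcDivSomeFrameAtGivenField W p hGZ hKo hB hSk hWu hGZK hnf hMaz hPT
    R1.localEulerPoincareCharacteristic_adicCompletion h32 hK hJn hJs hHn hHs hD hpar hss hX hp5 hK₀
    hodd hpd hμ hHN₀ hLt₀ hDiv hcert

end Records

/-! ### §3 The end-state class record over one field per pair, `hEP`-free -/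

/-- **ROUTE p2 — THE END-STATE CLASS RECORD OVER ONE FIELD PER PAIR, `hEP` discharged.**
`∀ (E, p) ∈` X11b, `p ≥ 5 → BSD(E, p)` from route p2's and the lever's published named facts
(+ Kolyvagin 1990 Thm. A, Skinner 2016 Thm. C, Cas18 Thms. 3.1–3.2 `h32`, BDMTV; NOT Hoffstein–Luo),
the ONE cited `hPT` (Poitou–Tate), and the typed inputs exactly as in gen 28's
`P2.bsdp_of_onTree_endStateAtGivenField`: (T1″) per surjective pair ONE admissible Heegner field
`K` with (2.4)∃♭ over `K` — THE open statement — and, only off the semistable pairs, value∃♭ over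
`K`; NOTHING per pair on the Locus; (REG) only where `p ∣ ∏c`; (TC) on ¬(ram) ∧ `p ∤ ∏c`; the
conjecture on split-only ∧ `p ∣ ∏c`; the corner. `hEP` (Milne I Thm. 2.8, now the kernel theorem
`GaloisImage.EPCTate.localEulerPoincareCharacteristic`) supplied by
`R1.localEulerPoincareCharacteristic_adicCompletion`; nothing else changed. CONDITIONAL; nothing
booked; labels UNCHANGED; X11b stays CONSTRUCTION-SHAPED.
[cite: Castella2018Erratum, (2.4) (p. 4)] [cite: Castella2018, Thms. 2.3, 3.1, 3.2, §5]
[cite: McCallumLMS1991, §1 Theorem (Kolyvagin), p. 296] [cite: Skinner2016PacificMC, Thm. C (§1)]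
[cite: Disegni2020, Thm. 1 (§1.2), (∗)] [cite: Wuthrich2014, Thm. 3 (p. 383), Prop. 21 (p. 400)]
[cite: SteinWuthrich2013, Thm. 6.1, §4.2] [cite: BalakrishnanEtAl2019, Thm. 1.2]
[cite: MilneADT2006, Ch. I, Thm. 2.8 (p. 31)] [cite: Miller2011LMS, Def. 1.1] -/
theorem P2.bsdp_of_onTree_endStateAtGivenFieldEP
    (hGZ : ∀ (N : ℕ) [NeZero N] (W : WeierstrassCurve ℚ) (K : Type) [Field K] [NumberField K],
      gross_zagier N W K)
    (hKo : ∀ (N : ℕ) [NeZero N] (W : WeierstrassCurve ℚ) (K : Type) [Field K] [NumberField K],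
      kolyvagin N W K)
    (hB : ∀ (N : ℕ) [NeZero N] (W : WeierstrassCurve ℚ) (K : Type) [Field K] [NumberField K],
      Kolyvagin1990_padicValNat_card_sha_le N W K)
    (hSk : Skinner2016.thmC_padicValRat_bsd_rank_zero) (hWu : sha_dvd_analyticSha)
    (hGZK : rank_eq_analyticRank_of_analyticRank_le_one) (hnf : exists_isNewformOf)
    (hMaz : mazur_not_dvd_maninConstant_of_odd) (hBDMTV : thm12_not_le_normalizer_splitCartan)
    (hPT : ∀ (K : Type) [Field K] [NumberField K], poitouTate_sum_localTatePairing_eq_zero K)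
    (h32 : thm32_exists_isBDPLFunction_valueAtOne)
    (hK : kato_charIdeal_dvd_multiplicative_of_surjective)
    (hJn : thm61_nonsplitMultiplicative) (hJs : thm61_splitMultiplicative)
    (hHn : exists_isMultCanonical) (hHs : exists_isSplitMultCanonical)
    (hD : thm1_padicBSD_rankOne_multiplicative) (hpar : nonempty_modularParametrizationData)
    (hField : ∀ (W : WeierstrassCurve ℚ) [W.IsElliptic] [W.IsGloballyMinimal] (p : ℕ) [Fact p.Prime],
      ClassX11b W p → 5 ≤ p → Surj W p →
      ∃ (K : Type) (_ : Field K) (_ : NumberField K), IsImaginaryQuadratic K ∧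
        Odd (NumberField.discr K) ∧ ¬ (p : ℤ) ∣ NumberField.discr K ∧ ¬ p ∣ Units.torsionOrder K ∧
        SatisfiesHeegnerHypothesis (W.conductorNorm ℤ) K ∧
        (W.quadraticTwist (NumberField.discr K : ℚ)).entireLFunction 1 ≠ 0 ∧
        P2.IMCDivSomeFrameOnTreeAtField W p K ∧
        (¬ Semistable W → P2.BDPValueSomeFrameOnTreeAtField W p K))
    (hReg : ∀ (W : WeierstrassCurve ℚ) [W.IsElliptic] [W.IsGloballyMinimal] (p : ℕ) [Fact p.Prime],
      ClassX11b W p → 5 ≤ p → Surj W p → p ∣ W.tamagawaProduct →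
      ClassClosure.RegulatorNonvanishingAt W p)
    (hTC : ∀ (W : WeierstrassCurve ℚ) [W.IsElliptic] [W.IsGloballyMinimal] (p : ℕ) [Fact p.Prime],
      ClassX11b W p → 5 ≤ p → Surj W p → ¬ Ram W p → ¬ p ∣ W.tamagawaProduct →
      ∃ (K : Type) (_ : Field K) (_ : NumberField K) (Wd : WeierstrassCurve ℚ) (_ : Wd.IsElliptic)
        (_ : Wd.IsGloballyMinimal) (Cd : VariableChange ℚ) (qd : ℚ),
        IsImaginaryQuadratic K ∧ SatisfiesHeegnerHypothesis (W.conductorNorm ℤ) K ∧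
        NumberField.discr K < -4 ∧ Cd • W.quadraticTwist (NumberField.discr K : ℚ) = Wd ∧
        Wd.entireLFunction 1 / (Wd.realPeriodRat : ℂ) = (qd : ℂ) ∧ qd ≠ 0 ∧ padicValRat p qd = 0)
    (hC : ∀ (W : WeierstrassCurve ℚ) [W.IsElliptic] [W.IsGloballyMinimal] (p : ℕ) [Fact p.Prime],
      ClassX11b W p → 5 ≤ p → W.HasSplitMultiplicativeReductionAtPrime p →
      (¬ ∃ (m : ℕ) (_ : Fact m.Prime), m ≠ p ∧ W.HasMultiplicativeReductionAtPrime m) →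
      p ∣ W.tamagawaProduct → ClassClosure.RelativeExceptionalLeadingTermAt W p)
    (hCorner : ∀ (W : WeierstrassCurve ℚ) [W.IsElliptic] [W.IsGloballyMinimal] (p : ℕ)
      [Fact p.Prime], ClassX11b W p → ¬ Surj W p → (p = 5 ∨ p = 7) →
        p ∣ padicValInt p W.minimalDiscriminantInt → ¬ Ram W p → Typed.MissingPPartAt W p)
    (W : WeierstrassCurve ℚ) [W.IsElliptic] [W.IsGloballyMinimal] (p : ℕ) [Fact p.Prime]
    (hX : ClassX11b W p) (hp5 : 5 ≤ p) : BSDp W p :=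
  P2.bsdp_of_onTree_endStateAtGivenField hGZ hKo hB hSk hWu hGZK hnf hMaz hBDMTV hPT
    R1.localEulerPoincareCharacteristic_adicCompletion h32 hK hJn hJs hHn hHs hD hpar hField hReg hTC
    hC hCorner W p hX hp5

end Summit.BirchSwinnertonDyer.Rank1Residual.X11b

end
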